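import Summits.MatrixMultiplication.OmegaCensus.STPP211CosetReflectA
import Summits.MatrixMultiplication.OmegaCensus.STPP211CosetLaw
import Summits.MatrixMultiplication.OmegaCensus.STPP211Z2pow6Codes
import Mathlib.Algebra.BigOperators.Group.Finset.Basic

/-!
# STPP (2,1,1) COSET LAW — part C2: soundness of the coset engine (`search = true` ⇒ `CosetBound`)

Cell `pub-omega` (unit `pub-omega-stpp-1-g36`), topic `Summits/MatrixMultiplication/OmegaCensus`.
HONEST FRAMING (verbatim): lottery ticket; floor = certified bounds/negative ranges. Census STRUCTURE bookkeeping (B5, `T1((ℤ/2)⁶)`, Pb237);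
nothing here is a bound on `ω`.

**`cosetBound_of_searchS`**: for a `c`-code list `cs : List ℕ` of length `k` (codes `< 64`), a coordinate hyperplane `Wb b` of `𝔽₂⁶` and a
threshold `T`, the kernel evaluation `T1CosetEng.searchS cs b T = true` proves `T1Coset.CosetBound (Wb b) (fun i => dec (cs.getD i 0)) T`: every rooted
`Wb b`-admissible labeled set (multiplicities `≤ 2`, root `(0, i₀)` of least label) has fewer than `T` members. With `STPP211CosetLaw`
(`no_family_of_coset_bound`) each `decide`d search is then a theorem «no `(2,1,1)^k` family `(Aᵢ, {0}, {dec csᵢ})`». (The list form —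
rather than `List.ofFn` of a function — keeps `decide +kernel` away from `Array.ofFn`'s well-founded recursion.)

Proof: along the members of a given admissible `Q` the search cannot answer `true` by pruning: the lanes of the packed state always
contain the codes of `Q`'s points of the open labels (`LaneOK`; preserved by `K ∧ LV u x` thanks to the completeness of the candidate
masks, part C1, and the pairwise law inside `Adm`), so the capacity bound dominates the number of remaining members (`fsum_le_cap2`), the
points of the current label are among the enumerated `x` / `x < y`, and at a leaf `n < T` is read off. The root is the member `(0, i₀)`.

References: H. Cohn, R. Kleinberg, B. Szegedy, C. Umans, FOCS 2005 (arXiv:math/0511460), Def. 5.1.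
-/

namespace Summit.MatrixMultiplication.OmegaCensus

namespace T1CosetEng

open STPP211Neg Finset T1Z2p6 T1Coset

/-! ## List plumbing -/

/-- The tables list reads back its entries. -/
theorem getD_mkTabsS (cs : List ℕ) (W k : ℕ) {u : ℕ} (hu : u < k) : (mkTabsS cs W k).getD u 0 = tabS cs W k u := by
  rw [mkTabsS, List.getD_eq_getElem?_getD, List.getElem?_map, List.getElem?_range hu]; rfl

/-- Membership in `restOf k s`: the labels strictly between `s` and `k`. -/
theorem mem_restOf {k s v : ℕ} : v ∈ restOf k s ↔ s < v ∧ v < k := by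
  rw [restOf, List.mem_map]
  refine ⟨fun ⟨j, hj, hv⟩ => by rw [List.mem_range] at hj; omega, fun ⟨h1, h2⟩ => ⟨v - (s + 1), List.mem_range.2 (by omega), by omega⟩⟩

/-- `restOf k s` has no duplicates. -/
theorem nodup_restOf (k s : ℕ) : (restOf k s).Nodup :=
  (List.nodup_range).map fun a b h => by simpa using h

/-- `cap2S` on a cons. -/
theorem cap2S_cons (K v : ℕ) (l : List ℕ) : cap2S K (v :: l) = upTo2 (laneS K v) + cap2S K l := rfl

/-- `goS` on a cons (the definition, with the recursive calls named). -/
theorem goS_cons (k : ℕ) (tabs : List ℕ) (T u : ℕ) (rest : List ℕ) (n K : ℕ) :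
    goS k tabs T (u :: rest) n K =
      (force (cap2S K (u :: rest)) fun bnd =>
      Nat.blt (Nat.add n bnd) T ||
      (goS k tabs T rest n K &&
        force (tabs.getD u 0) fun Tu =>
        force (laneS K u) fun L =>
        allBits L (fun x =>
          force (Nat.land (Nat.xor K (salt u x)) (lvS k Tu x)) fun K1 =>
          goS k tabs T rest (Nat.add n 1) K1 &&
          force (Nat.land (laneS K1 u) (Nat.xor full6 (lowMask (Nat.add x 1)))) fun L2 =>
          allBits L2 (fun y => goS k tabs T rest (Nat.add n 2) (Nat.land (Nat.xor K1 (salt u y)) (lvS k Tu y))) L2)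
        L)) := rfl

/-- `goS` on the empty schedule. -/
theorem goS_nil (k : ℕ) (tabs : List ℕ) (T n K : ℕ) : goS k tabs T [] n K = Nat.blt n T := rfl

/-! ## The salted readers -/

/-- Salted lanes distribute over `Nat.land`. -/
theorem laneS_land (A B t z : ℕ) : (laneS (Nat.land A B) t).testBit z = ((laneS A t).testBit z && (laneS B t).testBit z) :=
  lane_land A B (t + 1) z

/-- A salt is a 64-bit number. -/
theorem salt_lt (u x : ℕ) : salt u x < 2 ^ 64 := Nat.mod_lt _ (by norm_num)

/-- **The salt never touches a lane.** -/
theorem laneS_xor_salt (A u x t z : ℕ) : (laneS (Nat.xor A (salt u x)) t).testBit z = (laneS A t).testBit z := by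
  show (lane (Nat.xor A (salt u x)) (Nat.add t 1)).testBit z = (lane A (Nat.add t 1)).testBit z
  unfold lane
  rw [testBit_fld, testBit_fld, xor_eq, Nat.testBit_xor, add_eq']
  have : (salt u x).testBit (64 * (t + 1) + z) = false :=
    Nat.testBit_lt_two_pow (lt_of_lt_of_le (salt_lt u x) (Nat.pow_le_pow_right (by norm_num) (by omega)))
  rw [this, Bool.xor_false]

/-- **Salted lanes of a salted lane vector:** lane `t < k` of `lvecS l x` is `E t l x`, bitwise. -/
theorem testBit_laneS_lvecS (cs : List ℕ) (b : ℕ) {k t : ℕ} (ht : t < k) (l x z : ℕ) :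
    (laneS (lvecS cs (wmask b) k l x) t).testBit z = (emask cs (wmask b) t l x).testBit z := by
  show (lane (lvecS cs (wmask b) k l x) (Nat.add t 1)).testBit z = _
  rw [← testBit_lane_lvec cs b ht l x z]
  unfold lane lvecS
  rw [testBit_fld, testBit_fld, add_eq', lor_eq, Nat.testBit_lor, shiftLeft_eq', Nat.testBit_shiftLeft, T1Z2p5.testBit_lowMask]
  by_cases hz : z < 64
  · have h1 : 64 ≤ 64 * (t + 1) + z := by omega
    have h2 : ¬ (64 * (t + 1) + z < 64) := by omega
    have h3 : 64 * (t + 1) + z - 64 = 64 * t + z := by omega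
    simp [hz, h1, h2, h3]
  · simp [hz]

/-- A salted lane vector fits in `k + 1` fields. -/
theorem lvecS_lt (cs : List ℕ) (b k l x : ℕ) : lvecS cs (wmask b) k l x < 2 ^ (64 * (k + 1)) := by
  refine lt_two_pow_of_testBit _ _ fun j hj => ?_
  unfold lvecS
  rw [lor_eq, Nat.testBit_lor, shiftLeft_eq', Nat.testBit_shiftLeft, T1Z2p5.testBit_lowMask]
  have h1 : 64 ≤ j := by omega
  have h2 : ¬ j < 64 := by omega
  have h3 : (lvec cs (wmask b) k l x).testBit (j - 64) = false := by
    have := pack_lt (w := 64) (fun i => emask_lt cs b i l x) k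
    exact Nat.testBit_lt_two_pow (lt_of_lt_of_le this (Nat.pow_le_pow_right (by norm_num) (by omega)))
  simp [h1, h2, h3]

/-- **Fields of a salted table:** field `x < 64` of the salted table of label `l` is `lvecS l x`. -/
theorem lvS_tabS (cs : List ℕ) (b k l : ℕ) {x : ℕ} (hx : x < 64) :
    lvS k (tabS cs (wmask b) k l) x = lvecS cs (wmask b) k l x := by
  refine Nat.eq_of_testBit_eq fun z => ?_
  unfold lvS lv tabS
  exact testBit_fld_pack (fun i => by
    have := lvecS_lt cs b k l i
    rwa [mul_eq', add_eq']) hx z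

section Sound

variable {k : ℕ} {cs : List ℕ} (hlen : cs.length = k) (hcs : ∀ c ∈ cs, c < 64) {b : Fin 6} {Q : Finset (G6 × Fin k)}

include hlen hcs

set_option synthInstance.maxSize 16384

/-! ## Fibres of a labeled set and the lane invariant -/

omit hlen hcs in
/-- The members of `Q` with label (value) `v`. -/
def fib (Q : Finset (G6 × Fin k)) (v : ℕ) : Finset (G6 × Fin k) := Q.filter fun q => q.2.val = v

omit hlen hcs in
/-- `Σ_{v ∈ l} #fib v`. -/
def fsum (Q : Finset (G6 × Fin k)) (l : List ℕ) : ℕ := (l.map fun v => (fib Q v).card).sum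

omit hlen hcs in
/-- THE LANE INVARIANT: for every open label `v ∈ l`, the codes of `Q`'s points of label `v` are set bits of lane `v` of the salted state `K`. -/
def LaneOK (Q : Finset (G6 × Fin k)) (K : ℕ) (l : List ℕ) : Prop :=
  ∀ v ∈ l, ∀ q ∈ Q, q.2.val = v → (laneS K v).testBit (enc q.1) = true

omit hlen hcs in
/-- A fibre has at most two members when multiplicities are `≤ 2`. -/
theorem card_fib_le (hmult : ∀ i : Fin k, (Q.filter fun q => q.2 = i).card ≤ 2) (v : ℕ) : (fib Q v).card ≤ 2 := by
  by_cases hv : v < k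
  · have : fib Q v = Q.filter fun q => q.2 = ⟨v, hv⟩ := by
      unfold fib; congr; funext q; exact propext ⟨fun h => Fin.ext h, fun h => by rw [h]⟩
    rw [this]; exact hmult _
  · have : fib Q v = ∅ := by
      unfold fib; rw [filter_eq_empty_iff]; intro q _ h; exact hv (h ▸ q.2.isLt)
    rw [this]; simp

omit hlen hcs in
/-- **Capacity dominates:** under the lane invariant, `Σ_{v ∈ l} #fib v ≤ cap2S K l`. -/
theorem fsum_le_cap2S (hmult : ∀ i : Fin k, (Q.filter fun q => q.2 = i).card ≤ 2) {K : ℕ} :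
    ∀ l : List ℕ, LaneOK Q K l → fsum Q l ≤ cap2S K l
  | [], _ => le_rfl
  | v :: l, hL => by
      rw [cap2S_cons, fsum, List.map_cons, List.sum_cons]
      have h1 : (fib Q v).card ≤ upTo2 (laneS K v) :=
        card_le_upTo2 (fib Q v) (fun q => enc q.1)
          (fun q hq q' hq' h => by
            rw [mem_coe, fib, mem_filter] at hq hq'
            exact Prod.ext (enc_injective h) (Fin.ext (hq.2.trans hq'.2.symm)))
          (fun q hq => hL v List.mem_cons_self q (mem_filter.1 hq).1 (mem_filter.1 hq).2) (card_fib_le hmult v)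
      have h2 := fsum_le_cap2S hmult l fun v' hv' => hL v' (List.mem_cons_of_mem _ hv')
      exact Nat.add_le_add h1 h2

/-- **Completeness of the candidate masks on an admissible set:** for members `(x, i) ≠ (z, j)` of `Q`, the code of `z` is a set bit of
`E j i (enc x)`. -/
theorem emask_complete (hQ : Adm (Wb b) (fun i : Fin k => dec (cs.getD i.val 0)) Q) {x z : G6} {i j : Fin k} (hx : (x, i) ∈ Q)
    (hz : (z, j) ∈ Q) (hne : (x, i) ≠ (z, j)) : (emask cs (wmask b) j.val i.val (enc x)).testBit (enc z) = true := by
  have hzW : z ∈ Wb b := hQ.1 _ hz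
  have hget : ∀ m : Fin k, cs.getD m.val 0 ∈ cs := fun m => by
    rw [List.getD_eq_getElem?_getD, List.getElem?_eq_getElem (by rw [hlen]; exact m.isLt)]
    exact List.getElem_mem _
  refine testBit_emask_of (enc_lt z) ?_ ?_ ?_
  · rw [testBit_wmask, decide_eq_true (enc_lt z), mem_Wb.1 hzW]; rfl
  · intro cj hcj he
    obtain ⟨m, hm, rfl⟩ := List.getElem_of_mem hcj
    have hmk : m < k := hlen ▸ hm
    have hgm : cs.getD m 0 = cs[m] := by rw [List.getD_eq_getElem?_getD, List.getElem?_eq_getElem hm]; rfl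
    have h1 : enc (x - z) = enc (dec (cs.getD m 0) - dec (cs.getD j.val 0)) := by
      rw [enc_sub, enc_sub, enc_dec _ (hcs _ (hgm ▸ hcj)), enc_dec _ (hcs _ (hget j)), hgm, ← he, xor_eq, xor_eq, Nat.xor_comm]
    exact hQ.2 _ hx _ hz hne ⟨m, hmk⟩ (enc_injective h1)
  · intro cj hcj he
    obtain ⟨m, hm, rfl⟩ := List.getElem_of_mem hcj
    have hmk : m < k := hlen ▸ hm
    have hgm : cs.getD m 0 = cs[m] := by rw [List.getD_eq_getElem?_getD, List.getElem?_eq_getElem hm]; rfl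
    have h1 : enc (z - x) = enc (dec (cs.getD m 0) - dec (cs.getD i.val 0)) := by
      rw [enc_sub, enc_sub, enc_dec _ (hcs _ (hgm ▸ hcj)), enc_dec _ (hcs _ (hget i)), hgm, ← he]
    exact hQ.2 _ hz _ hx (Ne.symm hne) ⟨m, hmk⟩ (enc_injective h1)

/-- **The lane invariant survives a choice:** after `(K ⊕ salt) ∧ LVS i (enc x)` for a member `(x, i)`, every open label `v ≠ i` keeps its
points. -/
theorem laneOK_land (hQ : Adm (Wb b) (fun i : Fin k => dec (cs.getD i.val 0)) Q) {K : ℕ} {l : List ℕ} (hK : LaneOK Q K l) {x : G6} {i : Fin k}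
    (hx : (x, i) ∈ Q) (hl : ∀ v ∈ l, v < k ∧ v ≠ i.val) :
    LaneOK Q (Nat.land (Nat.xor K (salt i.val (enc x))) (lvS k (tabS cs (wmask b) k i.val) (enc x))) l := by
  intro v hv q hq hqv
  obtain ⟨hvk, hvi⟩ := hl v hv
  rw [laneS_land, laneS_xor_salt, hK v hv q hq hqv, Bool.true_and, lvS_tabS _ _ _ _ (enc_lt x), testBit_laneS_lvecS _ _ hvk]
  have hne : (x, i) ≠ (q.1, q.2) := fun e => hvi (by rw [← hqv, ← (Prod.ext_iff.1 e).2])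
  have := emask_complete hlen hcs hQ hx (show (q.1, q.2) ∈ Q from hq) hne
  rwa [hqv] at this

/-! ## Soundness of `go` -/

/-- **`go` is sound.** If the lanes of `K` contain the codes of `Q`'s points of the open labels `rest` (no duplicates, all `< k`) and
`goS … rest n K = true`, then `n + Σ_{v ∈ rest} #fib v < T`. -/
theorem goS_sound (hQ : Adm (Wb b) (fun i : Fin k => dec (cs.getD i.val 0)) Q) (hmult : ∀ i : Fin k, (Q.filter fun q => q.2 = i).card ≤ 2) (T : ℕ) :
    ∀ rest : List ℕ, rest.Nodup → (∀ v ∈ rest, v < k) → ∀ n K, LaneOK Q K rest →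
      goS k (mkTabsS cs (wmask b) k) T rest n K = true → n + fsum Q rest < T
  | [], _, _, n, K, _, h => by
      rw [goS_nil, Nat.blt_eq] at h
      rw [fsum, List.map_nil, List.sum_nil]; exact h
  | u :: rest, hnd, hlt, n, K, hL, h => by
      have huk : u < k := hlt u List.mem_cons_self
      have hurest : u ∉ rest := (List.nodup_cons.1 hnd).1
      have hnd' : rest.Nodup := (List.nodup_cons.1 hnd).2
      have hlt' : ∀ v ∈ rest, v < k := fun v hv => hlt v (List.mem_cons_of_mem _ hv)
      have hL' : LaneOK Q K rest := fun v hv => hL v (List.mem_cons_of_mem _ hv)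
      have hne_rest : ∀ (i : Fin k), i.val = u → ∀ v ∈ rest, v < k ∧ v ≠ i.val :=
        fun i hi v hv => ⟨hlt' v hv, fun e => hurest (by rw [← hi, ← e]; exact hv)⟩
      rw [goS_cons, force_eq, getD_mkTabsS _ _ _ huk] at h
      simp only [force_eq] at h
      rw [Bool.or_eq_true] at h
      have hsum : fsum Q (u :: rest) = (fib Q u).card + fsum Q rest := by
        rw [fsum, List.map_cons, List.sum_cons]; rfl
      rcases h with h | h
      · -- pruned by the capacity bound
        rw [Nat.blt_eq] at h
        have := fsum_le_cap2S hmult (u :: rest) hL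
        change n + cap2S K (u :: rest) < T at h
        omega
      rw [Bool.and_eq_true] at h
      obtain ⟨hskip, hall⟩ := h
      have h0 := goS_sound hQ hmult T rest hnd' hlt' n K hL' hskip
      -- the points of label `u`
      have hcard := card_fib_le hmult u
      rcases Nat.lt_or_ge (fib Q u).card 1 with hc | hc
      · have : (fib Q u).card = 0 := by omega
        rw [hsum, this]; omega
      rcases Nat.lt_or_ge (fib Q u).card 2 with hc2 | hc2
      · -- exactly one point `(x, i)`
        obtain ⟨p, hp⟩ := card_eq_one.1 (by omega : (fib Q u).card = 1)
        have hpQ : p ∈ fib Q u := by rw [hp]; exact mem_singleton_self _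
        rw [fib, mem_filter] at hpQ
        obtain ⟨hpQ, hpu⟩ := hpQ
        have hbit : (laneS K u).testBit (enc p.1) = true := hL u List.mem_cons_self p hpQ hpu
        have hbody := allBits_spec _ _ _ le_rfl hall (enc p.1) hbit
        rw [Bool.and_eq_true] at hbody
        have hL1 := laneOK_land hlen hcs hQ hL' (show (p.1, p.2) ∈ Q from hpQ) (hne_rest p.2 hpu)
        rw [hpu] at hL1
        have h1 := goS_sound hQ hmult T rest hnd' hlt' (n + 1) _ hL1 hbody.1
        rw [hsum, show (fib Q u).card = 1 by omega]; omega
      · -- exactly two points `(x, i), (y, i)` with `enc x < enc y`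
        have hc2' : (fib Q u).card = 2 := le_antisymm hcard hc2
        obtain ⟨p, q, hpq, hpq'⟩ := card_eq_two.1 hc2'
        have hpF : p ∈ fib Q u := by rw [hpq']; exact mem_insert_self _ _
        have hqF : q ∈ fib Q u := by rw [hpq']; exact mem_insert_of_mem (mem_singleton_self _)
        rw [fib, mem_filter] at hpF hqF
        -- order the two points by code
        have key : ∀ a c : G6 × Fin k, a ∈ Q → a.2.val = u → c ∈ Q → c.2.val = u → enc a.1 < enc c.1 → n + 2 + fsum Q rest < T := by
          intro a c haQ hau hcQ hcu hlt2
          have hac : (a.1, a.2) ≠ (c.1, c.2) := fun e => by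
            have := (Prod.ext_iff.1 e).1; simp only at this; rw [this] at hlt2; exact lt_irrefl _ hlt2
          have hbit : (laneS K u).testBit (enc a.1) = true := hL u List.mem_cons_self a haQ hau
          have hbody := allBits_spec _ _ _ le_rfl hall (enc a.1) hbit
          rw [Bool.and_eq_true] at hbody
          set K1 := Nat.land (Nat.xor K (salt u (enc a.1))) (lvS k (tabS cs (wmask b) k u) (enc a.1)) with hK1
          have hL1 : LaneOK Q K1 rest := by
            have := laneOK_land hlen hcs hQ hL' (show (a.1, a.2) ∈ Q from haQ) (hne_rest a.2 hau)
            rwa [hau] at this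
          -- the code of `c` is in `L2`
          have hbit2 : (Nat.land (laneS K1 u) (Nat.xor full6 (lowMask (Nat.add (enc a.1) 1)))).testBit (enc c.1) = true := by
            rw [land_eq, Nat.testBit_land, xor_eq, Nat.testBit_xor, testBit_full6, T1Z2p5.testBit_lowMask, add_eq',
              decide_eq_true (enc_lt c.1), decide_eq_false (show ¬ enc c.1 < enc a.1 + 1 by omega), hK1, laneS_land,
              laneS_xor_salt, hL u List.mem_cons_self c hcQ hcu, lvS_tabS _ _ _ _ (enc_lt a.1), testBit_laneS_lvecS _ _ huk]
            have := emask_complete hlen hcs hQ (show (a.1, a.2) ∈ Q from haQ) (show (c.1, c.2) ∈ Q from hcQ) hac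
            rw [hcu, hau] at this
            rw [this]; rfl
          have hbody2 := allBits_spec _ _ _ le_rfl hbody.2 (enc c.1) hbit2
          have hL2 : LaneOK Q (Nat.land (Nat.xor K1 (salt u (enc c.1))) (lvS k (tabS cs (wmask b) k u) (enc c.1))) rest := by
            have := laneOK_land hlen hcs hQ hL1 (show (c.1, c.2) ∈ Q from hcQ) (hne_rest c.2 hcu)
            rwa [hcu] at this
          exact goS_sound hQ hmult T rest hnd' hlt' (n + 2) _ hL2 hbody2
        have hne : enc p.1 ≠ enc q.1 := fun e => hpq (Prod.ext (enc_injective e) (Fin.ext (hpF.2.trans hqF.2.symm)))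
        rw [hsum, hc2']
        rcases Nat.lt_or_gt_of_ne hne with hlt2 | hgt2
        · have := key p q hpF.1 hpF.2 hqF.1 hqF.2 hlt2; omega
        · have := key q p hqF.1 hqF.2 hpF.1 hpF.2 hgt2; omega

/-! ## Soundness of the root and of the search -/

omit hlen hcs in
/-- `root` (the definition, with `force` spelled out). -/
theorem rootS_eq (k : ℕ) (tabs : List ℕ) (T s : ℕ) : rootS k tabs T s =
    (force (tabs.getD s 0) fun Ts =>
    force (lvS k Ts 0) fun K0 =>
    force (laneS K0 s) fun L =>
    force (Nat.add (@Bool.rec (fun _ => ℕ) 1 0 (Nat.beq L 0)) (cap2S K0 (restOf k s))) fun bnd =>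
    Nat.blt (Nat.add 1 bnd) T ||
    (goS k tabs T (restOf k s) 1 K0 && allBits L (fun x => goS k tabs T (restOf k s) 2 (Nat.land (Nat.xor K0 (salt s x)) (lvS k Ts x))) L)) := rfl

omit hlen hcs in
/-- The number of members is the sum of the fibre sizes over the root label and the labels above it. -/
theorem card_eq_fsum {s : ℕ} (hmin : ∀ q ∈ Q, s ≤ q.2.val) : Q.card = (fib Q s).card + fsum Q (restOf k s) := by
  have hnd : (s :: restOf k s).Nodup := List.nodup_cons.2 ⟨fun h => by rw [mem_restOf] at h; omega, nodup_restOf k s⟩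
  have h1 : Q.card = ∑ v ∈ (s :: restOf k s).toFinset, (Q.filter fun q => q.2.val = v).card :=
    card_eq_sum_card_fiberwise fun q hq => by
      rw [mem_coe] at hq
      rw [mem_coe, List.mem_toFinset, List.mem_cons, mem_restOf]
      have := hmin q hq; have := q.2.isLt; omega
  rw [h1, List.sum_toFinset _ hnd, List.map_cons, List.sum_cons]; rfl

/-- **`root` is sound.** If `Q` is admissible with multiplicities `≤ 2`, rooted at `(0, i₀)` with all labels `≥ i₀`, and
`rootS … i₀ = true`, then `#Q < T`. -/
theorem rootS_sound (hQ : Adm (Wb b) (fun i : Fin k => dec (cs.getD i.val 0)) Q) (hmult : ∀ i : Fin k, (Q.filter fun q => q.2 = i).card ≤ 2) (T : ℕ)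
    {i₀ : Fin k} (hroot : ((0 : G6), i₀) ∈ Q) (hmin : ∀ q ∈ Q, i₀ ≤ q.2)
    (h : rootS k (mkTabsS cs (wmask b) k) T i₀.val = true) : Q.card < T := by
  have hsk : i₀.val < k := i₀.isLt
  rw [rootS_eq, force_eq, getD_mkTabsS _ _ _ hsk, force_eq, force_eq, force_eq, lvS_tabS _ _ _ _ (by norm_num : 0 < 64),
    Bool.or_eq_true] at h
  -- the lane invariant at the root
  have hL0 : LaneOK Q (lvecS cs (wmask b) k i₀.val 0) (restOf k i₀.val) := by
    intro v hv q hq hqv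
    rw [mem_restOf] at hv
    rw [testBit_laneS_lvecS _ _ hv.2]
    have hne : ((0 : G6), i₀) ≠ (q.1, q.2) := fun e => by
      have h2 : i₀ = q.2 := (Prod.ext_iff.1 e).2
      have : i₀.val = v := by rw [h2]; exact hqv
      omega
    have := emask_complete hlen hcs hQ hroot (show (q.1, q.2) ∈ Q from hq) hne
    rwa [hqv, enc_zero] at this
  have hcnt : Q.card = (fib Q i₀.val).card + fsum Q (restOf k i₀.val) := card_eq_fsum (fun q hq => hmin q hq)
  have hcardF : (fib Q i₀.val).card ≤ 2 := card_fib_le hmult i₀.val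
  have hrootF : ((0 : G6), i₀) ∈ fib Q i₀.val := mem_filter.2 ⟨hroot, rfl⟩
  -- a second point of the root label has its code in the root laneS
  have hsecond : ∀ p ∈ fib Q i₀.val, p ≠ ((0 : G6), i₀) →
      (laneS (lvecS cs (wmask b) k i₀.val 0) i₀.val).testBit (enc p.1) = true := by
    intro p hp hpne
    rw [fib, mem_filter] at hp
    rw [testBit_laneS_lvecS _ _ hsk]
    have hne : ((0 : G6), i₀) ≠ (p.1, p.2) := fun e => hpne (by rw [Prod.ext_iff] at e ⊢; exact ⟨e.1.symm, e.2.symm⟩)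
    have := emask_complete hlen hcs hQ hroot (show (p.1, p.2) ∈ Q from hp.1) hne
    rwa [hp.2, enc_zero] at this
  have hrest : ∀ v ∈ restOf k i₀.val, v < k := fun v hv => (mem_restOf.1 hv).2
  rcases h with h | h
  · -- pruned at the root
    rw [Nat.blt_eq] at h
    change 1 + ((@Bool.rec (fun _ => ℕ) 1 0 (Nat.beq (laneS (lvecS cs (wmask b) k i₀.val 0) i₀.val) 0)) +
      cap2S (lvecS cs (wmask b) k i₀.val 0) (restOf k i₀.val)) < T at h
    have hcap : fsum Q (restOf k i₀.val) ≤ cap2S (lvecS cs (wmask b) k i₀.val 0) (restOf k i₀.val) :=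
      fsum_le_cap2S hmult _ hL0
    have hfib : (fib Q i₀.val).card ≤
        1 + @Bool.rec (fun _ => ℕ) 1 0 (Nat.beq (laneS (lvecS cs (wmask b) k i₀.val 0) i₀.val) 0) := by
      rcases Nat.lt_or_ge (fib Q i₀.val).card 2 with h2 | h2
      · exact le_trans (by omega) (Nat.le_add_right 1 _)
      · obtain ⟨p, hp, hpne⟩ := exists_mem_ne (lt_of_lt_of_le one_lt_two h2) ((0 : G6), i₀)
        rw [beq_zero_eq_false_of_testBit (hsecond p hp hpne)]
        exact le_trans hcardF (le_refl 2)
    omega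
  · rw [Bool.and_eq_true] at h
    obtain ⟨h1, h2⟩ := h
    rcases Nat.lt_or_ge (fib Q i₀.val).card 2 with hc | hc
    · have hgo := goS_sound hlen hcs hQ hmult T (restOf k i₀.val) (nodup_restOf k i₀.val) hrest 1 _ hL0 h1
      omega
    · obtain ⟨p, hp, hpne⟩ := exists_mem_ne (lt_of_lt_of_le one_lt_two hc) ((0 : G6), i₀)
      have hbody := allBits_spec _ _ _ le_rfl h2 (enc p.1) (hsecond p hp hpne)
      rw [fib, mem_filter] at hp
      have hne : ∀ v ∈ restOf k i₀.val, v < k ∧ v ≠ p.2.val := fun v hv => by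
        have hv' := mem_restOf.1 hv
        refine ⟨hv'.2, fun e => ?_⟩
        have : i₀.val < v := hv'.1
        rw [e, hp.2] at this
        exact lt_irrefl _ this
      have hL1 := laneOK_land hlen hcs hQ hL0 (show (p.1, p.2) ∈ Q from hp.1) hne
      rw [hp.2] at hL1
      have hgo := goS_sound hlen hcs hQ hmult T (restOf k i₀.val) (nodup_restOf k i₀.val) hrest 2 _ hL1 hbody
      omega

end Sound

/-- **THE COSET ENGINE IS SOUND.** A kernel evaluation `searchS cs b T = true` for a code list `cs` of length `k` (codes `< 64`) proves
the coset bound `CosetBound (Wb b) (fun i => dec (cs.getD i 0)) T` of `STPP211CosetLaw`. [cite: CohnKleinbergSzegedyUmans2005, Def. 5.1] -/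
theorem cosetBound_of_searchS {k : ℕ} {cs : List ℕ} (hlen : cs.length = k) (hcs : ∀ c ∈ cs, c < 64) (b : Fin 6) {T : ℕ}
    (h : searchS cs b.val T = true) : CosetBound (Wb b) (fun i : Fin k => dec (cs.getD i.val 0)) T := by
  intro Q hQ hmult i₀ hroot hmin
  unfold searchS at h
  rw [force_eq, hlen, List.all_eq_true] at h
  exact rootS_sound hlen hcs hQ hmult T hroot hmin (h _ (List.mem_range.2 i₀.isLt))

end T1CosetEng

end Summit.MatrixMultiplication.OmegaCensus
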